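import Mathlib
import HarnessLib
import Summits.ValiantsHypothesis.ValiantsHypothesis.Theses.MonotoneRestoration
import Literature.Computability.AlgebraicComplexity.ArithCircuit
import Literature.Computability.AlgebraicComplexity.ArithCircuitProofs
import Literature.Computability.AlgebraicComplexity.MonotoneStructure
import Literature.Computability.AlgebraicComplexity.PermanentIrreducible
import Literature.ModelTheory.FiniteModelTheory.CkEquiv
import Summits.ValiantsHypothesis.ValiantsHypothesis.Theorems.MonotoneRestorationMonotoneRestorationQPCosetCount
import Summits.ValiantsHypothesis.ValiantsHypothesis.Theorems.MonotoneRestorationMonotoneRestorationQPSymmetricLB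
import Summits.ValiantsHypothesis.ValiantsHypothesis.Theorems.MonotoneRestorationMonotoneRestorationQPSupportSymmetrisation
import Summits.ValiantsHypothesis.ValiantsHypothesis.Theorems.MonotoneRestorationMonotoneRestorationQPSparseRegime
import Summits.ValiantsHypothesis.ValiantsHypothesis.Theorems.MonotoneRestorationMonotoneRestorationQPBeta
import Literature.Computability.AlgebraicComplexity.SymmetricArithCircuit
import Literature.Computability.AlgebraicComplexity.DawarWilsenach2025Proofs
import Literature.GroupTheory.PermutationGroups.SmallIndexSubgroups
import Summits.ValiantsHypothesis.ValiantsHypothesis.Theorems.MonotoneRestorationQP.Negative.LoadBearing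
import Summits.ValiantsHypothesis.ValiantsHypothesis.Theorems.MonotoneRestorationMonotoneRestorationQPPermSupportCount

/-! TTRL-lite variant V20203 of stmt-ValiantsHypothesis-15886 -/

-- `Summit.ValiantsHypothesis.ValiantsHypothesis.…` is the tree's mandated single-conjunct layout
-- (Sub = Summit), so the duplicated namespace component is intended.
set_option linter.dupNamespace false

namespace Summit.ValiantsHypothesis.ValiantsHypothesis.Theorems

open Summit.ValiantsHypothesis.ValiantsHypothesis.Theses.MonotoneRestoration
open Literature.Computability.AlgebraicComplexity

/-- TTRL-lite variant V20203 of `stub_esymmRowSums_structure` (stmt-ValiantsHypothesis-15886):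
the row-sum substitution of the `k`-th elementary symmetric polynomial, evaluated at ANY
function-graph 0/1 matrix (exactly one `1` per row, at column `g i` — e.g. every permutation
matrix), equals `n.choose k`: each row sum evaluates to `1`, and `esymm` at the all-ones point
counts the `k`-subsets of `Fin n`. -/
theorem stub_esymmRowSums_structure_var20203 :
    ∀ (n k : ℕ) (g : Fin n → Fin n),
      MvPolynomial.eval (fun p : Fin n × Fin n => if p.2 = g p.1 then (1 : NNReal) else 0)
        (MvPolynomial.bind₁ (fun i : Fin n => ∑ j : Fin n, MvPolynomial.X (i, j))
          (MvPolynomial.esymm (Fin n) NNReal k)) = (n.choose k : NNReal) := by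
  intro n k g
  have hb : MvPolynomial.eval (fun p : Fin n × Fin n => if p.2 = g p.1 then (1 : NNReal) else 0)
        (MvPolynomial.bind₁ (fun i : Fin n => ∑ j : Fin n, MvPolynomial.X (i, j))
          (MvPolynomial.esymm (Fin n) NNReal k)) =
      MvPolynomial.eval (fun i : Fin n =>
        MvPolynomial.eval (fun p : Fin n × Fin n => if p.2 = g p.1 then (1 : NNReal) else 0)
          (∑ j : Fin n, MvPolynomial.X (i, j))) (MvPolynomial.esymm (Fin n) NNReal k) :=
    MvPolynomial.eval₂Hom_bind₁ _ _ _ _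
  rw [hb]
  have hrow : (fun i : Fin n =>
      MvPolynomial.eval (fun p : Fin n × Fin n => if p.2 = g p.1 then (1 : NNReal) else 0)
        (∑ j : Fin n, MvPolynomial.X (i, j))) = fun _ => (1 : NNReal) := by
    funext i
    simp only [map_sum, MvPolynomial.eval_X]
    rw [Finset.sum_ite_eq' Finset.univ (g i) (fun _ => (1 : NNReal))]
    simp
  rw [hrow]
  simp only [MvPolynomial.esymm, map_sum, map_prod, MvPolynomial.eval_X, Finset.prod_const_one,
    Finset.sum_const, Finset.card_powersetCard, Finset.card_univ, Fintype.card_fin]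
  simp
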